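import Mathlib
import Summits.Ventures.HodgeRepro2.T5CornerSimple

/-!
# The corner determines the simple module: `e • N ≅ e • N' ≠ 0 ⇒ N ≅ N'`

Blind cell `pub-hodge-repro2`, seat p8 (gen 6), Tier-5 kernel support for the N3 record
(MVW chap. 2 III.5 at the K-level; CHECK-N3 §7 row N3.10.3).  `T5CornerSimple` (p392753) records
«`π₁^K` is a simple `H(G₁, K)`-module for `π₁` irreducible with `π₁^K ≠ 0`» as
`isSimpleModule_cornerModule`: for an idempotent `e` of a ring `R` and a simple `R`-module `N`
with `e • N ≠ 0`, `e • N` is a simple module over the corner ring `eRe`.  This file records the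
companion statement that the K-level DETERMINES the irreducible: two simple `R`-modules whose
corners are isomorphic non-zero `eRe`-modules are isomorphic (Bernstein / Bushnell–Henniart's
bijection between irreducible smooth representations with `π^K ≠ 0` and simple `H(G, K)`-modules,
injectivity half; every step is module theory).

Proof (kernel form below).  Let `φ : e • N ≃ e • N'` and let `W ⊆ e • (N × N')` be the graph of
`φ`, a simple `eRe`-submodule; let `P = R · W ⊆ N × N'`.  The first projection `P → N` is non-zero,
hence onto; a `p ∈ P` with `p.1 = 0` satisfies `e • r • p ∈ W ∩ ({0} × N') = 0` for all `r`, so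
`e • p = 0`; the second coordinates of such `p` form an `R`-submodule of the simple `N'`, which
cannot be all of `N'` (some `n' ∈ N'` has `e • n' ≠ 0`), so `p = 0`.  Thus `P ≅ N`, and
symmetrically `P ≅ N'`.

* `eq_zero_of_map_eq_zero_of_smul_mem` — the kernel argument in the abstract (an `R`-submodule
  `P` with `e • R • P ⊆ S`, two maps `f, g` separating points with `f` injective on `S` and `g`
  into a simple module with `e • Q' ≠ 0`: `p ∈ P`, `f p = 0 ⇒ p = 0`);
* `graphMap` / `graph` — the graph of `φ` inside `e • (N × N')`, a simple `eRe`-submodule;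
* `linearEquiv_of_cornerModule_linearEquiv` — **the theorem**: `Nonempty (N ≃ₗ[R] N')`.

In the record: `R = H(G₁)⁺`, `e = e_K`, `N, N'` irreducible smooth, `e • N = N^K`.  What stays
prose: smooth representations = non-degenerate `H(G₁)`-modules, `e_K • π = π^K`; the printed
theorems.  Nothing arithmetic is asserted.

README §8(d): uses an L-value-free non-vanishing device: NO.
-/

namespace Summit.Ventures.HodgeRepro2.T5CornerDetermines

open Summit.Ventures.HodgeRepro2.T5CornerSimple

section Kernel

variable {R : Type*} [Ring R] {e : R}
  {V Q Q' : Type*} [AddCommGroup V] [Module R V] [AddCommGroup Q] [Module R Q]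
  [AddCommGroup Q'] [Module R Q']

/-- **The kernel argument.** Let `P ≤ V` be an `R`-submodule with `e • r • p ∈ S` for all `p ∈ P`,
`r ∈ R`, and let `f : V → Q`, `g : V → Q'` be `R`-linear with `ker f ⊓ ker g = 0`, `f` injective on
`S`, `Q'` simple and `e • Q' ≠ 0`.  Then `p ∈ P`, `f p = 0` force `p = 0`. -/
theorem eq_zero_of_map_eq_zero_of_smul_mem [IsSimpleModule R Q'] (P : Submodule R V) (S : Set V)
    (hP : ∀ p ∈ P, ∀ r : R, e • r • p ∈ S) (f : V →ₗ[R] Q) (g : V →ₗ[R] Q')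
    (hS : ∀ s ∈ S, f s = 0 → s = 0) (hfg : ∀ v : V, f v = 0 → g v = 0 → v = 0)
    (hQ' : ∃ q' : Q', e • q' ≠ 0) {p : V} (hp : p ∈ P) (hfp : f p = 0) : p = 0 := by
  -- every `y ∈ P` with `f y = 0` has `e • y = 0`
  have hK : ∀ y ∈ P, f y = 0 → e • y = 0 := by
    intro y hy hfy
    have h1 := hS _ (hP y hy 1) (by rw [map_smul, map_smul, hfy, smul_zero, smul_zero])
    rwa [one_smul] at h1
  -- the second coordinates of the kernel form a submodule of the simple `Q'`
  let K : Submodule R V := P ⊓ LinearMap.ker f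
  have hpK : p ∈ K := ⟨hp, hfp⟩
  have hso : IsSimpleOrder (Submodule R Q') := ‹IsSimpleModule R Q'›.toIsSimpleOrder
  rcases hso.eq_bot_or_eq_top (K.map g) with h | h
  · have hg : g p = 0 := by
      have : g p ∈ K.map g := Submodule.mem_map_of_mem hpK
      rw [h, Submodule.mem_bot] at this
      exact this
    exact hfg p hfp hg
  · exfalso
    obtain ⟨q', hq'⟩ := hQ'
    have : q' ∈ K.map g := by rw [h]; trivial
    obtain ⟨y, hyK, hy⟩ := this
    apply hq'
    rw [← hy, ← map_smul, hK y hyK.1 hyK.2, map_zero]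

end Kernel

section Graph

variable {R : Type*} [Ring R] {e : R} (he : IsIdempotentElem e)
  {N N' : Type*} [AddCommGroup N] [Module R N] [AddCommGroup N'] [Module R N']

include he in
/-- A pair with both coordinates fixed by `e` is fixed by `e` in `N × N'`. -/
theorem mk_mem_cornerModule_prod {x : N} {y : N'} (hx : x ∈ cornerModule e N)
    (hy : y ∈ cornerModule e N') : (x, y) ∈ cornerModule e (N × N') := by
  rw [mem_cornerModule_iff he] at hx hy ⊢
  rw [Prod.smul_mk, hx, hy]

/-- The graph map `e • N → e • (N × N')`, `x ↦ (x, φ x)`, `eRe`-linear. -/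
def graphMap (φ : ↥(cornerModule e N) →ₗ[he.Corner] ↥(cornerModule e N')) :
    ↥(cornerModule e N) →ₗ[he.Corner] ↥(cornerModule e (N × N')) where
  toFun x := ⟨((x : N), ((φ x : ↥(cornerModule e N')) : N')), mk_mem_cornerModule_prod he x.2 (φ x).2⟩
  map_add' x y := by
    apply Subtype.ext
    change ((x : N) + (y : N), ((φ (x + y) : ↥(cornerModule e N')) : N')) =
      ((x : N), ((φ x : ↥(cornerModule e N')) : N')) + ((y : N), ((φ y : ↥(cornerModule e N')) : N'))
    rw [map_add, Prod.mk_add_mk]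
    rfl
  map_smul' c x := by
    apply Subtype.ext
    change (c.1 • (x : N), ((φ (c • x) : ↥(cornerModule e N')) : N')) =
      c.1 • ((x : N), ((φ x : ↥(cornerModule e N')) : N'))
    rw [map_smul, Prod.smul_mk]
    rfl

/-- The coordinates of `graphMap φ x`. -/
@[simp] theorem graphMap_val (φ : ↥(cornerModule e N) →ₗ[he.Corner] ↥(cornerModule e N'))
    (x : ↥(cornerModule e N)) :
    ((graphMap he φ x : ↥(cornerModule e (N × N'))) : N × N') =
      ((x : N), ((φ x : ↥(cornerModule e N')) : N')) := rfl

/-- The graph map is injective. -/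
theorem graphMap_injective (φ : ↥(cornerModule e N) →ₗ[he.Corner] ↥(cornerModule e N')) :
    Function.Injective (graphMap he φ) := by
  intro x y hxy
  have := congrArg (fun z : ↥(cornerModule e (N × N')) => ((z : N × N').1)) hxy
  simp only [graphMap_val] at this
  exact Subtype.ext this

/-- The graph of `φ` as an `eRe`-submodule of `e • (N × N')`. -/
def graph (φ : ↥(cornerModule e N) →ₗ[he.Corner] ↥(cornerModule e N')) :
    Submodule he.Corner ↥(cornerModule e (N × N')) :=
  LinearMap.range (graphMap he φ)

/-- The graph is isomorphic to `e • N`. -/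
noncomputable def graphEquiv (φ : ↥(cornerModule e N) →ₗ[he.Corner] ↥(cornerModule e N')) :
    ↥(cornerModule e N) ≃ₗ[he.Corner] graph he φ :=
  LinearEquiv.ofInjective (graphMap he φ) (graphMap_injective he φ)

/-- For `N` simple with `e • N ≠ 0`, the graph is a simple `eRe`-module. -/
theorem isSimpleModule_graph [IsSimpleModule R N] (hN : ∃ n : N, e • n ≠ 0)
    (φ : ↥(cornerModule e N) →ₗ[he.Corner] ↥(cornerModule e N')) :
    IsSimpleModule he.Corner (graph he φ) :=
  haveI : IsSimpleModule he.Corner ↥(cornerModule e N) := isSimpleModule_cornerModule he hN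
  IsSimpleModule.congr (graphEquiv he φ).symm

/-- Elements of the graph with first coordinate `0` are `0`. -/
theorem eq_zero_of_fst_eq_zero (φ : ↥(cornerModule e N) →ₗ[he.Corner] ↥(cornerModule e N'))
    {s : N × N'} (hs : s ∈ Subtype.val '' (graph he φ : Set ↥(cornerModule e (N × N'))))
    (h1 : s.1 = 0) : s = 0 := by
  obtain ⟨z, ⟨x, rfl⟩, rfl⟩ := hs
  rw [graphMap_val] at h1 ⊢
  have hx : x = 0 := Subtype.ext h1
  rw [hx, map_zero]
  rfl

/-- Elements of the graph of an injective `φ` with second coordinate `0` are `0`. -/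
theorem eq_zero_of_snd_eq_zero (φ : ↥(cornerModule e N) →ₗ[he.Corner] ↥(cornerModule e N'))
    (hφ : Function.Injective φ)
    {s : N × N'} (hs : s ∈ Subtype.val '' (graph he φ : Set ↥(cornerModule e (N × N'))))
    (h2 : s.2 = 0) : s = 0 := by
  obtain ⟨z, ⟨x, rfl⟩, rfl⟩ := hs
  rw [graphMap_val] at h2 ⊢
  have hx : x = 0 := by
    apply hφ
    rw [map_zero]
    exact Subtype.ext h2
  rw [hx, map_zero]
  rfl

end Graph

section Main

variable {R : Type*} [Ring R] {e : R} (he : IsIdempotentElem e)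
  {N N' : Type*} [AddCommGroup N] [Module R N] [AddCommGroup N'] [Module R N']

/-- If `e • N ≠ 0` and `e • N ≅ e • N'` then `e • N' ≠ 0`. -/
theorem exists_smul_ne_zero_of_equiv (hN : ∃ n : N, e • n ≠ 0)
    (φ : ↥(cornerModule e N) ≃ₗ[he.Corner] ↥(cornerModule e N')) : ∃ n' : N', e • n' ≠ 0 := by
  obtain ⟨n, hn⟩ := hN
  have hx : (⟨e • n, (mem_cornerModule_iff' (e := e)).mpr ⟨n, rfl⟩⟩ : ↥(cornerModule e N)) ≠ 0 :=
    fun h => hn (congrArg Subtype.val h)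
  refine ⟨((φ ⟨e • n, (mem_cornerModule_iff' (e := e)).mpr ⟨n, rfl⟩⟩ : ↥(cornerModule e N')) : N'), ?_⟩
  rw [(mem_cornerModule_iff he).mp (φ _).2]
  intro h0
  apply hx
  apply φ.injective
  rw [map_zero]
  exact Subtype.ext h0

/-- **The corner determines the simple module.** For simple `R`-modules `N`, `N'` with
`e • N ≠ 0` and `e • N ≅ e • N'` as `eRe`-modules, `N ≅ N'` as `R`-modules. -/
theorem linearEquiv_of_cornerModule_linearEquiv [IsSimpleModule R N] [IsSimpleModule R N']
    (hN : ∃ n : N, e • n ≠ 0)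
    (φ : ↥(cornerModule e N) ≃ₗ[he.Corner] ↥(cornerModule e N')) : Nonempty (N ≃ₗ[R] N') := by
  have hN' := exists_smul_ne_zero_of_equiv he hN φ
  -- the graph and its `R`-span
  set W := graph he (φ : ↥(cornerModule e N) →ₗ[he.Corner] ↥(cornerModule e N')) with hW
  haveI : IsSimpleModule he.Corner W := isSimpleModule_graph he hN _
  set P : Submodule R (N × N') := spanOf he W with hPdef
  have hPW : ∀ p ∈ P, ∀ r : R, e • r • p ∈ Subtype.val '' (W : Set ↥(cornerModule e (N × N'))) :=
    fun p hp r => smul_mem_of_mem_spanOf he W hp r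
  have hsub : ∀ x : ↥(cornerModule e N),
      (((graphMap he φ x : ↥(cornerModule e (N × N'))) : N × N')) ∈ P :=
    fun x => Submodule.subset_span ⟨graphMap he φ x, ⟨x, rfl⟩, rfl⟩
  have hfg : ∀ v : N × N', (LinearMap.fst R N N') v = 0 → (LinearMap.snd R N N') v = 0 → v = 0 :=
    fun v h1 h2 => Prod.ext h1 h2
  -- a non-zero element of `e • N`
  obtain ⟨n, hn⟩ := hN
  set x₀ : ↥(cornerModule e N) := ⟨e • n, (mem_cornerModule_iff' (e := e)).mpr ⟨n, rfl⟩⟩ with hx₀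
  have hx₀ne : (x₀ : N) ≠ 0 := hn
  -- first projection: `P ≃ N`
  have hf : Function.Bijective ((LinearMap.fst R N N').comp P.subtype) := by
    constructor
    · rw [← LinearMap.ker_eq_bot, eq_bot_iff]
      intro y hy
      rw [LinearMap.mem_ker] at hy
      have : (y : N × N') = 0 :=
        eq_zero_of_map_eq_zero_of_smul_mem P _ hPW (LinearMap.fst R N N') (LinearMap.snd R N N')
          (fun s hs h => eq_zero_of_fst_eq_zero he _ hs h) hfg hN' y.2 (by simpa using hy)
      exact Submodule.coe_eq_zero.mp this
    · apply LinearMap.surjective_of_ne_zero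
      intro h0
      apply hx₀ne
      have := LinearMap.congr_fun h0 ⟨_, hsub x₀⟩
      simpa using this
  -- second projection: `P ≃ N'`
  have hg : Function.Bijective ((LinearMap.snd R N N').comp P.subtype) := by
    constructor
    · rw [← LinearMap.ker_eq_bot, eq_bot_iff]
      intro y hy
      rw [LinearMap.mem_ker] at hy
      have : (y : N × N') = 0 :=
        eq_zero_of_map_eq_zero_of_smul_mem P _ hPW (LinearMap.snd R N N') (LinearMap.fst R N N')
          (fun s hs h => eq_zero_of_snd_eq_zero he _ φ.injective hs h)
          (fun v h2 h1 => hfg v h1 h2) ⟨n, hn⟩ y.2 (by simpa using hy)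
      exact Submodule.coe_eq_zero.mp this
    · apply LinearMap.surjective_of_ne_zero
      intro h0
      have hφx : ((φ x₀ : ↥(cornerModule e N')) : N') ≠ 0 := by
        intro h
        apply hx₀ne
        have : φ x₀ = 0 := Subtype.ext h
        rw [map_eq_zero_iff φ φ.injective] at this
        exact congrArg Subtype.val this
      apply hφx
      have := LinearMap.congr_fun h0 ⟨_, hsub x₀⟩
      simpa using this
  exact ⟨(LinearEquiv.ofBijective _ hf).symm.trans (LinearEquiv.ofBijective _ hg)⟩

end Main

end Summit.Ventures.HodgeRepro2.T5CornerDetermines
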